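import Summits.KontsevichZagierPeriods.KontsevichZagierPeriods.Theses.HurwitzMicroSectors
import Summits.KontsevichZagierPeriods.KontsevichZagierPeriods.Theorems.HurwitzMicroSectorsNormalFormPrinciplePiBoxTransfer
import Summits.KontsevichZagierPeriods.KontsevichZagierPeriods.Theorems.HurwitzMicroSectorsNormalFormPrincipleVariants2302

/-! TTRL-lite variant V2305 of stmt-KontsevichZagierPeriods-3869

Variant V2305 = `stub_boxRigidity` (the leaf `BoxRigidity` of `NormalFormPrinciple`: two representations
on open unit boxes with integrands of KZ's rational shape `p/q` over `ℚ` and equal values are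
KZ-equivalent) under the two-sided move `fix_nat:m=6; bound_nat:m'≤3`. Verdict of the attempt seat:
**open** — this file is the exact-strength certificate, not a proof of the variant. With
`BoxVanishing K` := "a box-rational representation of dimension `K` and value `0` is a relation", the
tree's graded lemmas (`boxVanishingDim_left_of_pair`, `boxRigidityLe_of_boxVanishingDim`, file
`…Variants2238`) pin the variant exactly: `V2305 ⟺ BoxVanishing 6 ⟺ BoxRigidity for all m, m' ≤ 6 ⟺ V2302`
(`fix_nat:m=6; bound_nat:m'≤2`), so relaxing the bound `m' ≤ 2` to `m' ≤ 3` changes nothing.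
`BoxVanishing 6` contains, e.g., "for `a b : ℚ`, `a + b·ζ(5) = 0 ⇒ [a + b/(1 − x₁⋯x₅)]_{(0,1)⁶}` is a
relation" (provable today only through the open irrationality of `ζ(5)`), so no proof is available;
conversely `KontsevichZagierPeriods → V2305` (`stub_boxRigidity_var2305_of_statement`), so a refutation
of the variant would refute the Summit, and the tree has no invariant of `KZ.relations` finer than
`KZ.eval`. Source: M. Kontsevich, D. Zagier, *Periods* (2001), §1.2 Conjecture 1. Pure proof file, no
definitions. -/

-- `Summit.<Summit>.<Problem>` is the tree's mandated summit-side namespace (CONVENTIONS §2); for this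
-- single-conjunct summit the two coincide, so the duplicate is deliberate.
set_option linter.dupNamespace false

noncomputable section

namespace Summit.KontsevichZagierPeriods.KontsevichZagierPeriods.Theorems

open MeasureTheory Set
open Literature.NumberTheory.Transcendental Literature.NumberTheory.Transcendental.KZ
open Summit.KontsevichZagierPeriods.KontsevichZagierPeriods.Theses.HurwitzMicroSectors
open Summit.KontsevichZagierPeriods.HurwitzMicroSectors.NormalFormPrinciple.PiBox

/-- **V2305 ⟺ `BoxVanishing 6`**: (⇒) the pair `(6, 0)` is allowed (`0 ≤ 3`), so compare a vanishing
box-rational representation on `(0,1)⁶` with the zero representation on the point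
(`boxVanishingDim_left_of_pair`); (⇐) `boxRigidityLe_of_boxVanishingDim 6` with `m = 6`, `m' ≤ 3 ≤ 6`.
[cite: KontsevichZagier2001, §1.2 Conjecture 1] -/
theorem stub_boxRigidity_var2305_iff_boxVanishing_six :
    (∀ (m' : ℕ) (N : IntegralRep 6) (N' : IntegralRep m'), m' ≤ 3 → N.domain = {x | ∀ i, x i ∈ Set.Ioo (0:ℝ) 1} → N.IsRational → N'.domain = {x | ∀ i, x i ∈ Set.Ioo (0:ℝ) 1} → N'.IsRational → N.value = N'.value → Equivalent N N') ↔
    (∀ (M : IntegralRep 6), M.domain = {x | ∀ i, x i ∈ Set.Ioo (0:ℝ) 1} → M.IsRational →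
      M.value = 0 → of M ∈ relations) :=
  ⟨fun h => boxVanishingDim_left_of_pair 6 0 fun N N' => h 0 N N' (Nat.zero_le 3),
    fun hvan m' N N' hm' =>
      boxRigidityLe_of_boxVanishingDim 6 hvan 6 m' N N' le_rfl (hm'.trans (by norm_num))⟩

/-- **V2305 ⟺ the sibling V2302** (`fix_nat:m=6; bound_nat:m'≤2`): both are `BoxVanishing 6`
(`stub_boxRigidity_var2302_iff_boxVanishing_six`), so the relaxed bound `m' ≤ 3` adds nothing.
[cite: KontsevichZagier2001, §1.2 Conjecture 1] -/
theorem stub_boxRigidity_var2305_iff_var2302 :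
    (∀ (m' : ℕ) (N : IntegralRep 6) (N' : IntegralRep m'), m' ≤ 3 → N.domain = {x | ∀ i, x i ∈ Set.Ioo (0:ℝ) 1} → N.IsRational → N'.domain = {x | ∀ i, x i ∈ Set.Ioo (0:ℝ) 1} → N'.IsRational → N.value = N'.value → Equivalent N N') ↔
    (∀ (m' : ℕ) (N : IntegralRep 6) (N' : IntegralRep m'), m' ≤ 2 → N.domain = {x | ∀ i, x i ∈ Set.Ioo (0:ℝ) 1} → N.IsRational → N'.domain = {x | ∀ i, x i ∈ Set.Ioo (0:ℝ) 1} → N'.IsRational → N.value = N'.value → Equivalent N N') := by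
  rw [stub_boxRigidity_var2305_iff_boxVanishing_six, stub_boxRigidity_var2302_iff_boxVanishing_six]

/-- **V2305 ⟺ `BoxRigidity` for all `m, m' ≤ 6`** (the honest strength of the variant: Conjecture 1 for
all pairs of rational integrands on the open unit boxes of dimension at most `6`).
[cite: KontsevichZagier2001, §1.2 Conjecture 1] -/
theorem stub_boxRigidity_var2305_iff_le_six :
    (∀ (m' : ℕ) (N : IntegralRep 6) (N' : IntegralRep m'), m' ≤ 3 → N.domain = {x | ∀ i, x i ∈ Set.Ioo (0:ℝ) 1} → N.IsRational → N'.domain = {x | ∀ i, x i ∈ Set.Ioo (0:ℝ) 1} → N'.IsRational → N.value = N'.value → Equivalent N N') ↔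
    (∀ (m m' : ℕ) (N : IntegralRep m) (N' : IntegralRep m'), m ≤ 6 → m' ≤ 6 →
      N.domain = {x | ∀ i, x i ∈ Set.Ioo (0:ℝ) 1} → N.IsRational →
      N'.domain = {x | ∀ i, x i ∈ Set.Ioo (0:ℝ) 1} → N'.IsRational →
      N.value = N'.value → Equivalent N N') := by
  rw [stub_boxRigidity_var2305_iff_var2302]
  exact stub_boxRigidity_var2302_iff_le_six

/-- **`BoxVanishing 6` alone already proves V2305** (the residual of the variant, stated as the
missing lemma). [cite: KontsevichZagier2001, §1.2 Conjecture 1] -/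
theorem stub_boxRigidity_var2305_of_boxVanishing_six
    (hvan : ∀ (M : IntegralRep 6), M.domain = {x | ∀ i, x i ∈ Set.Ioo (0:ℝ) 1} → M.IsRational →
      M.value = 0 → of M ∈ relations) :
    ∀ (m' : ℕ) (N : IntegralRep 6) (N' : IntegralRep m'), m' ≤ 3 → N.domain = {x | ∀ i, x i ∈ Set.Ioo (0:ℝ) 1} → N.IsRational → N'.domain = {x | ∀ i, x i ∈ Set.Ioo (0:ℝ) 1} → N'.IsRational → N.value = N'.value → Equivalent N N' :=
  stub_boxRigidity_var2305_iff_boxVanishing_six.2 hvan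

/-- **The parent leaf ⇒ V2305** (specialisation `m := 6`, drop the bound).
[cite: KontsevichZagier2001, §1.2 Conjecture 1] -/
theorem stub_boxRigidity_var2305_of_parent
    (h : ∀ (m m' : ℕ) (N : IntegralRep m) (N' : IntegralRep m'), N.domain = {x | ∀ i, x i ∈ Set.Ioo (0:ℝ) 1} → N.IsRational → N'.domain = {x | ∀ i, x i ∈ Set.Ioo (0:ℝ) 1} → N'.IsRational → N.value = N'.value → Equivalent N N') :
    ∀ (m' : ℕ) (N : IntegralRep 6) (N' : IntegralRep m'), m' ≤ 3 → N.domain = {x | ∀ i, x i ∈ Set.Ioo (0:ℝ) 1} → N.IsRational → N'.domain = {x | ∀ i, x i ∈ Set.Ioo (0:ℝ) 1} → N'.IsRational → N.value = N'.value → Equivalent N N' :=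
  fun m' N N' _ => h 6 m' N N'

/-- **`KontsevichZagierPeriods ⇒ V2305`**: the variant is a special case of Conjecture 1 for the
tree's calculus (`leaves_of_statement`) — so a refutation of the variant would refute the Summit.
[cite: KontsevichZagier2001, §1.2 Conjecture 1] -/
theorem stub_boxRigidity_var2305_of_statement (h : _root_.KontsevichZagierPeriods) :
    ∀ (m' : ℕ) (N : IntegralRep 6) (N' : IntegralRep m'), m' ≤ 3 → N.domain = {x | ∀ i, x i ∈ Set.Ioo (0:ℝ) 1} → N.IsRational → N'.domain = {x | ∀ i, x i ∈ Set.Ioo (0:ℝ) 1} → N'.IsRational → N.value = N'.value → Equivalent N N' :=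
  stub_boxRigidity_var2305_of_parent (leaves_of_statement h).1

end Summit.KontsevichZagierPeriods.KontsevichZagierPeriods.Theorems

end
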